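import Literature.Analysis.FluidPDE.QuasiSelfSimilarFamilyEstimates
import Literature.Analysis.FluidPDE.QuasiSelfSimilarMixing
import HarnessLib

/-!
# Bruè–De Lellis Thm. 4.1 from the Alberti–Crippa–Mazzucato building blocks

Topic `Literature/Analysis/FluidPDE` (trunk FluidKinetic, family `turb`). The reduction of the
vendored fact `alberti_crippa_mazzucato_family` (`QuasiSelfSimilarMixing.lean`; Bruè–De Lellis,
CMP 400 (2023), Thm. 4.1 (a)–(d) and (4.10), item (c) per level) to the purely geometric fact
`acm_building_blocks` (`QuasiSelfSimilarBuildingBlocks.lean`; existence of the building blocks of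
BDL §4.1 whose patches (4.3)–(4.4) are smooth, compactly supported in the open square at each
level, and hand over): `alberti_crippa_mazzucato_family_of_building_blocks`. All the analysis of
BDL Thm. 4.1 / Alberti–Crippa–Mazzucato 2019, §6 — transport and incompressibility of the
patched fields, the Hölder scaling (a) and (4.10), the normalisations and the mixing estimate (b) —
is proved in `QuasiSelfSimilarFamilyEstimates.lean`; this file assembles. What remains a named
fact is exactly the "Peano snake" geometry of ACM §8, which the source gives by pictures.

The `n`-uniform reading of BDL (c) vendored as `alberti_crippa_mazzucato_quasi_self_similar` is
NOT derivable along this route (it contradicts the structure (4.3), see the discussion in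
`QuasiSelfSimilarMixing.lean`).

## References

* E. Bruè, C. De Lellis, *Anomalous dissipation for the forced 3D Navier–Stokes equations*,
  Comm. Math. Phys. 400 (2023), Thm. 4.1, (4.3)–(4.4), (4.9)–(4.10).
* G. Alberti, G. Crippa, A. L. Mazzucato, *Exponential self-similar mixing by incompressible
  flows*, J. Amer. Math. Soc. 32 (2019), §6 (scaling analysis), §8 (Peano snake).
* A. Cheskidov, *Dissipation anomaly and anomalous dissipation in incompressible fluid flows*,
  arXiv:2311.04182 (2023), Thm. 3.1.
-/

noncomputable section

open MeasureTheory Set Filter Function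
open scoped Topology NNReal ContDiff

namespace Literature.Analysis.FluidPDE

open QuasiSelfSimilar FunctionSpaces FunctionSpaces.Torus

/-- The convective blocks `DV_i(s)(z)[V_i(s,z)]` are jointly smooth. [folklore] -/
theorem QuasiSelfSimilar.contDiff_uncurry_convect_block {N : ℕ}
    {V : Fin N → ℝ → EuclideanSpace ℝ (Fin 2) → EuclideanSpace ℝ (Fin 2)} {i : Fin N}
    (hV : ContDiff ℝ ((⊤ : ℕ∞) : WithTop ℕ∞) (uncurry (V i))) :
    ContDiff ℝ ((⊤ : ℕ∞) : WithTop ℕ∞)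
      (uncurry fun s z => fderiv ℝ (V i s) z (V i s z)) := by
  have hf : ContDiff ℝ ((⊤ : ℕ∞) : WithTop ℕ∞)
      (uncurry fun (p : ℝ × EuclideanSpace ℝ (Fin 2)) (w : EuclideanSpace ℝ (Fin 2)) => V i p.1 w) := by
    have : (uncurry fun (p : ℝ × EuclideanSpace ℝ (Fin 2)) (w : EuclideanSpace ℝ (Fin 2)) =>
        V i p.1 w) = uncurry (V i) ∘ fun q => (q.1.1, q.2) := by
      funext q; rfl
    rw [this]
    exact hV.comp (contDiff_fst.fst.prodMk contDiff_snd)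
  have hD : ContDiff ℝ ((⊤ : ℕ∞) : WithTop ℕ∞)
      fun p : ℝ × EuclideanSpace ℝ (Fin 2) => fderiv ℝ (V i p.1) p.2 :=
    ContDiff.fderiv hf contDiff_snd (by simp)
  exact hD.clm_apply hV

/-- **Bruè–De Lellis 2023, Thm. 4.1 from the building blocks.** The structural fact
`acm_building_blocks` (ACM's Peano-snake blocks patched smoothly, BDL (4.3)–(4.4)) implies the
quasi-self-similar mixing family `alberti_crippa_mazzucato_family`: items (a), (b), (4.10) and
the transport/divergence-free structure are the scaling analysis
(`QuasiSelfSimilarFamilyEstimates.lean`), items (c) (per level) and (d) are carried by the fact.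
[cite: BrueDeLellisCMP2023, Thm. 4.1] [cite: AlbertiCrippaMazzucato2019, §6, Lemma 18, Thm. 19] -/
theorem alberti_crippa_mazzucato_family_of_building_blocks (h : acm_building_blocks) :
    alberti_crippa_mazzucato_family := by
  obtain ⟨N, V, Θ, ι, hB, hsmooth, hsupp, hd⟩ := h
  refine ⟨fun n => scalar Θ ι n, fun n => velocity V ι n, fun n =>
    isClassicalScalarTransportOn hB (hsmooth n).1 (hsmooth n).2, ?_, ?_, ?_, ?_, ?_, hd⟩
  · -- (a): `x ↦ ∂ₜᵏ v_n(t)(x)` is the patch of the blocks `mₙ⁻¹ ∂ₜᵏ V_i(t)`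
    intro j k r hr
    have hΦ : ∀ i, ContDiff ℝ ((⊤ : ℕ∞) : WithTop ℕ∞)
        (uncurry fun t z => iteratedDeriv k (fun s => V i s z) t) := fun i =>
      (hB.smooth_velocity i).uncurry_iteratedDeriv_slice k
    refine exists_holder_bound (ι := ι) hΦ
      (F := fun n t x => iteratedDerivWithin k (fun s => velocity V ι n s x) (Icc 0 1) t)
      (fun n t ht => (hsmooth n).2.isSmooth_iteratedDerivWithin_slice
        (uniqueDiffOn_Icc zero_lt_one) k ht) (fun n t ht => ?_) j hr.le
    funext x
    change iteratedDerivWithin k (fun s => ((mesh n : ℝ)⁻¹) • V (ι n (cellIndex (mesh n) (repr x))) s (cellCoord (mesh n) (repr x)))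
        (Icc 0 1) t = ((mesh n : ℝ)⁻¹) • iteratedDeriv k (fun s => V (ι n (cellIndex (mesh n) (repr x))) s (cellCoord (mesh n) (repr x))) t
    rw [iteratedDerivWithin_Icc_eq_iteratedDeriv_of_contDiff zero_lt_one
      ((contDiff_line (hB.smooth_velocity _) _ k).const_smul _) ht,
      iteratedDeriv_fun_const_smul_field]
  · -- (4.10): `x ↦ ∂ₜᵏ (v_n·∇v_n)(t)(x)` is the patch of the blocks `mₙ⁻¹ ∂ₜᵏ (DV_i[V_i])(t)`
    intro j k r hr _
    have hΦ : ∀ i, ContDiff ℝ ((⊤ : ℕ∞) : WithTop ℕ∞)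
        (uncurry fun t z => iteratedDeriv k (fun s => fderiv ℝ (V i s) z (V i s z)) t) := fun i =>
      (contDiff_uncurry_convect_block (hB.smooth_velocity i)).uncurry_iteratedDeriv_slice k
    refine exists_holder_bound (ι := ι) hΦ
      (F := fun n t x => iteratedDerivWithin k
        (fun s => Torus.convect (velocity V ι n s) (velocity V ι n s) x) (Icc 0 1) t)
      (fun n t ht => ((hsmooth n).2.convect (hsmooth n).2
        (uniqueDiffOn_Icc zero_lt_one)).isSmooth_iteratedDerivWithin_slice
          (uniqueDiffOn_Icc zero_lt_one) k ht) (fun n t ht => ?_) j hr.le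
    funext x
    have hm : (mesh n : ℝ) ≠ 0 := by exact_mod_cast (mesh_pos n).ne'
    -- on `[0,1]` the convective term is the rescaled block
    have heq : EqOn (fun s => Torus.convect (velocity V ι n s) (velocity V ι n s) x)
        (fun s => ((mesh n : ℝ)⁻¹) • fderiv ℝ (V (ι n (cellIndex (mesh n) (repr x))) s) (cellCoord (mesh n) (repr x))
          (V (ι n (cellIndex (mesh n) (repr x))) s (cellCoord (mesh n) (repr x)))) (Icc 0 1) := by
      intro s hs
      dsimp only
      rw [Torus.convect, fderiv_velocity hB ((hsmooth n).2.isSmooth_slice hs), velocity_eq,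
        map_smul]
    change iteratedDerivWithin k (fun s => Torus.convect (velocity V ι n s) (velocity V ι n s) x)
        (Icc 0 1) t = ((mesh n : ℝ)⁻¹) • iteratedDeriv k
          (fun s => fderiv ℝ (V (ι n (cellIndex (mesh n) (repr x))) s) (cellCoord (mesh n) (repr x)) (V (ι n (cellIndex (mesh n) (repr x))) s (cellCoord (mesh n) (repr x)))) t
    rw [iteratedDerivWithin_congr heq ht,
      iteratedDerivWithin_Icc_eq_iteratedDeriv_of_contDiff zero_lt_one
        ((contDiff_line (contDiff_uncurry_convect_block (hB.smooth_velocity _)) _ k).const_smul _)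
        ht, iteratedDeriv_fun_const_smul_field]
  · -- (b), normalisations
    exact fun n t ht => ⟨integral_scalar hB n ht, integral_scalar_sq hB n ht, abs_scalar_le hB n ht⟩
  · -- (b), gradient and `Ḣ⁻¹`
    obtain ⟨B, hB0, hBd⟩ := exists_norm_gradient_scalar_le hB fun n => (hsmooth n).1
    refine ⟨max (2 * B) (2 * Real.pi * Real.sqrt 2), fun n t ht => ⟨fun x => ?_, ?_⟩⟩
    · calc ‖Torus.gradient (scalar Θ ι n t) x‖ ≤ B * (2 * 5 ^ n) := hBd n t ht x
        _ = 2 * B * 5 ^ n := by ring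
        _ ≤ max (2 * B) (2 * Real.pi * Real.sqrt 2) * 5 ^ n :=
          mul_le_mul_of_nonneg_right (le_max_left _ _) (by positivity)
    · refine (eHomSobolevSeminorm_scalar_le hB n ht ((hsmooth n).1.isSmooth_slice ht)).trans ?_
      refine ENNReal.ofReal_le_ofReal ?_
      exact mul_le_mul_of_nonneg_right (le_max_right _ _) (by positivity)
  · -- (c), per level
    intro n
    obtain ⟨K, hK, hKsub, hKz⟩ := hsupp n
    exact ⟨K, hK, hKsub, hKz⟩

end Literature.Analysis.FluidPDE
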